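import Summits.KontsevichZagierPeriods.KontsevichZagierPeriods.Theses.SymplecticScissors
import Summits.KontsevichZagierPeriods.KontsevichZagierPeriods.Theorems.SymplecticScissorsPlanarCompilerStubElementaryMovesAux2
import Summits.KontsevichZagierPeriods.KontsevichZagierPeriods.Theorems.SymplecticScissorsPlanarCompilerStubElementaryMovesAux3

/-!
# `PlanarCompiler` (crux stmt-KontsevichZagierPeriods-10058), line `twist-restoring-shear`: stub `stub_elementaryMoves`

`Θ` KILLS THE ELEMENTARY MOVES: a cell compiler `Θ` (an additive map on `FormalRep` sending a
1-dimensional representation `[∫_σ f]` to `[cell f⁺] − [cell f⁻]`, the honest integrand-`1` planar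
representations on the open subgraphs of `f` and `−f` over `σ`, and every other generator to `0`)
maps every instance of the moves 1a (domain additivity), 1b (integrand additivity) and 2 (change of
variables), of any dimension, into the planar set-chain group
`G = closure((domainAddRel ∪ changeOfVariablesRel) ∩ closure{[s] : s planar, integrand 1})`.
Instances of dimension `≠ 1` are killed by `Θ`. In dimension one: 1a becomes two vertical cuts
(`domainAdd_cells_mem_planarGroup`); for 1b (`integrandAdd_cells_mem_planarGroup`), off a null set
of verticals the four functions `f^±, f₁^±` are differentiable (generic smoothness), there
`f⁺ + f₁⁻ + f₂⁻ = f⁻ + f₁⁺ + f₂⁺`, and open subgraphs of sums of non-negative functions split by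
shear-and-stack (helper file II); rule 2 is `changeOfVariables_cells_mem_planarGroup` (helper file
III: the push-forward `(x, y) ↦ (Φ x, y / |Φ' x|)` off finitely many verticals).
-/

noncomputable section

open MeasureTheory Set
open Literature.NumberTheory.Transcendental Literature.ModelTheory.ExponentialFields
open Summit.KontsevichZagierPeriods.KontsevichZagierPeriods.Theses.SymplecticScissors
open Summit.KontsevichZagierPeriods.SymplecticScissors.PlanarK0InjectiveNegative

namespace Summit.KontsevichZagierPeriods.SymplecticScissors.PlanarCompilerProof

namespace ElementaryMoves

/-- **Generic differentiability of two functions at once**: two `ℚ`-semialgebraic functions on a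
`ℚ`-semialgebraic subset `D` of the line are differentiable on a common open `ℚ`-semialgebraic
`U ⊆ D` with `D \ U` null (`KZ.exists_isOpen_contDiffOn` twice). [Bochnak–Coste–Roy 1998, §2.9] -/
theorem exists_isOpen_differentiableOn₂ {D : Set (Fin 1 → ℝ)} {v w : (Fin 1 → ℝ) → ℝ}
    (hD : IsSemialgebraic ℚ D) (hv : IsSemialgebraicFunOn ℚ D v) (hw : IsSemialgebraicFunOn ℚ D w) :
    ∃ U : Set (Fin 1 → ℝ), U ⊆ D ∧ IsOpen U ∧ IsSemialgebraic ℚ U ∧ DifferentiableOn ℝ v U ∧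
      DifferentiableOn ℝ w U ∧ volume (D \ U) = 0 := by
  obtain ⟨G₁, hG₁D, hG₁o, hG₁s, hG₁c, -, hG₁0⟩ := KZ.exists_isOpen_contDiffOn hD hv
  obtain ⟨G₂, -, hG₂o, hG₂s, hG₂c, -, hG₂0⟩ := KZ.exists_isOpen_contDiffOn hD hw
  refine ⟨G₁ ∩ G₂, fun x hx => hG₁D hx.1, hG₁o.inter hG₂o, hG₁s.inter hG₂s,
    (hG₁c.differentiableOn (by simp)).mono inter_subset_left,
    (hG₂c.differentiableOn (by simp)).mono inter_subset_right, ?_⟩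
  have : D \ (G₁ ∩ G₂) ⊆ (D \ G₁) ∪ (D \ G₂) := by
    intro x hx
    by_cases h : x ∈ G₁
    · exact Or.inr ⟨hx.1, fun h2 => hx.2 ⟨h, h2⟩⟩
    · exact Or.inl ⟨hx.1, h⟩
  exact measure_mono_null this (measure_union_null hG₁0 hG₂0)

/-- **Rule 1b in dimension one is killed by the cell compiler.** For 1-dimensional
representations `ρ, ρ₁, ρ₂` on a common domain `σ` with `f = f₁ + f₂` on `σ`, and integrand-`1`
planar representations on the open subgraphs of `f, −f, f₁, −f₁, f₂, −f₂` over `σ`,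
`([s] − [t]) − ([s₁] − [t₁]) − ([s₂] − [t₂])` lies in the planar set-chain group.
[Kontsevich–Zagier 2001, §1.2, rules (1), (2)] -/
theorem integrandAdd_cells_mem_planarGroup (ρ ρ₁ ρ₂ : KZ.IntegralRep 1)
    (h₁ : ρ₁.domain = ρ.domain) (h₂ : ρ₂.domain = ρ.domain)
    (hf : EqOn ρ.integrand (ρ₁.integrand + ρ₂.integrand) ρ.domain)
    (s t s₁ t₁ s₂ t₂ : KZ.IntegralRep 2)
    (hsd : s.domain = {p : Fin 2 → ℝ | (fun _ : Fin 1 => p 0) ∈ ρ.domain ∧ 0 < p 1 ∧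
      p 1 < ρ.integrand (fun _ : Fin 1 => p 0)})
    (htd : t.domain = {p : Fin 2 → ℝ | (fun _ : Fin 1 => p 0) ∈ ρ.domain ∧ 0 < p 1 ∧
      p 1 < -ρ.integrand (fun _ : Fin 1 => p 0)})
    (hs₁d : s₁.domain = {p : Fin 2 → ℝ | (fun _ : Fin 1 => p 0) ∈ ρ₁.domain ∧ 0 < p 1 ∧
      p 1 < ρ₁.integrand (fun _ : Fin 1 => p 0)})
    (ht₁d : t₁.domain = {p : Fin 2 → ℝ | (fun _ : Fin 1 => p 0) ∈ ρ₁.domain ∧ 0 < p 1 ∧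
      p 1 < -ρ₁.integrand (fun _ : Fin 1 => p 0)})
    (hs₂d : s₂.domain = {p : Fin 2 → ℝ | (fun _ : Fin 1 => p 0) ∈ ρ₂.domain ∧ 0 < p 1 ∧
      p 1 < ρ₂.integrand (fun _ : Fin 1 => p 0)})
    (ht₂d : t₂.domain = {p : Fin 2 → ℝ | (fun _ : Fin 1 => p 0) ∈ ρ₂.domain ∧ 0 < p 1 ∧
      p 1 < -ρ₂.integrand (fun _ : Fin 1 => p 0)})
    (hs : ∀ p ∈ s.domain, s.integrand p = 1) (ht : ∀ p ∈ t.domain, t.integrand p = 1)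
    (hs₁ : ∀ p ∈ s₁.domain, s₁.integrand p = 1) (ht₁ : ∀ p ∈ t₁.domain, t₁.integrand p = 1)
    (hs₂ : ∀ p ∈ s₂.domain, s₂.integrand p = 1) (ht₂ : ∀ p ∈ t₂.domain, t₂.integrand p = 1) :
    (KZ.of s - KZ.of t) - (KZ.of s₁ - KZ.of t₁) - (KZ.of s₂ - KZ.of t₂) ∈ planarGroup := by
  -- notation
  set σ := ρ.domain with hσ_def
  set f := ρ.integrand with hf_def
  set f₁ := ρ₁.integrand with hf₁_def
  set f₂ := ρ₂.integrand with hf₂_def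
  have hσ : IsSemialgebraic ℚ σ := ρ.isSemialgebraic_domain
  have hfσ : IsSemialgebraicFunOn ℚ σ f := ρ.isSemialgebraicFunOn_integrand
  have hf₁σ : IsSemialgebraicFunOn ℚ σ f₁ := h₁ ▸ ρ₁.isSemialgebraicFunOn_integrand
  have hf₂σ : IsSemialgebraicFunOn ℚ σ f₂ := h₂ ▸ ρ₂.isSemialgebraicFunOn_integrand
  -- a common open set of differentiability of `f⁺, f⁻, f₁⁺, f₁⁻`, co-null in `σ`
  obtain ⟨U₁, hU₁σ, hU₁o, hU₁s, hdfp, hdfn, hU₁0⟩ := exists_isOpen_differentiableOn₂ hσ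
    (isSemialgebraicFunOn_posPart hfσ) (isSemialgebraicFunOn_negPart hfσ)
  obtain ⟨U, hUU₁, hUo, hUs, hdf1p, hdf1n, hU0'⟩ := exists_isOpen_differentiableOn₂ hU₁s
    ((isSemialgebraicFunOn_posPart hf₁σ).mono hU₁σ hU₁s) ((isSemialgebraicFunOn_negPart hf₁σ).mono hU₁σ hU₁s)
  have hUσ : U ⊆ σ := hUU₁.trans hU₁σ
  have hU0 : volume (σ \ U) = 0 := by
    have : σ \ U ⊆ (σ \ U₁) ∪ (U₁ \ U) := by
      intro x hx
      by_cases h : x ∈ U₁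
      · exact Or.inr ⟨h, hx.2⟩
      · exact Or.inl ⟨hx.1, h⟩
    exact measure_mono_null this (measure_union_null hU₁0 hU0')
  have hfp : IsSemialgebraicFunOn ℚ U (fun x => max (f x) 0) := (isSemialgebraicFunOn_posPart hfσ).mono hUσ hUs
  have hfn : IsSemialgebraicFunOn ℚ U (fun x => max (-f x) 0) := (isSemialgebraicFunOn_negPart hfσ).mono hUσ hUs
  have hf1p : IsSemialgebraicFunOn ℚ U (fun x => max (f₁ x) 0) := (isSemialgebraicFunOn_posPart hf₁σ).mono hUσ hUs
  have hf1n : IsSemialgebraicFunOn ℚ U (fun x => max (-f₁ x) 0) := (isSemialgebraicFunOn_negPart hf₁σ).mono hUσ hUs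
  have hf2p : IsSemialgebraicFunOn ℚ U (fun x => max (f₂ x) 0) := (isSemialgebraicFunOn_posPart hf₂σ).mono hUσ hUs
  have hf2n : IsSemialgebraicFunOn ℚ U (fun x => max (-f₂ x) 0) := (isSemialgebraicFunOn_negPart hf₂σ).mono hUσ hUs
  replace hdfp : DifferentiableOn ℝ (fun x => max (f x) 0) U := hdfp.mono hUU₁
  replace hdfn : DifferentiableOn ℝ (fun x => max (-f x) 0) U := hdfn.mono hUU₁
  -- restrict the six cells to `U`
  obtain ⟨sU, hsUd, hsU, esU⟩ := exists_restrict_cell s hs hsd hUs hUσ hU0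
  obtain ⟨tU, htUd, htU, etU⟩ := exists_restrict_cell t ht (f := fun x => -f x) htd hUs hUσ hU0
  obtain ⟨s₁U, hs₁Ud, hs₁U, es₁U⟩ := exists_restrict_cell s₁ hs₁ (P := σ) (f := f₁) (by rw [hs₁d, h₁]) hUs hUσ hU0
  obtain ⟨t₁U, ht₁Ud, ht₁U, et₁U⟩ := exists_restrict_cell t₁ ht₁ (P := σ) (f := fun x => -f₁ x)
    (by rw [ht₁d, h₁]) hUs hUσ hU0
  obtain ⟨s₂U, hs₂Ud, hs₂U, es₂U⟩ := exists_restrict_cell s₂ hs₂ (P := σ) (f := f₂) (by rw [hs₂d, h₂]) hUs hUσ hU0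
  obtain ⟨t₂U, ht₂Ud, ht₂U, et₂U⟩ := exists_restrict_cell t₂ ht₂ (P := σ) (f := fun x => -f₂ x)
    (by rw [ht₂d, h₂]) hUs hUσ hU0
  -- pass to positive parts in the domain descriptions
  rw [band_eq_band_posPart U f] at hsUd
  rw [band_eq_band_posPart U (fun x => -f x)] at htUd
  rw [band_eq_band_posPart U f₁] at hs₁Ud
  rw [band_eq_band_posPart U (fun x => -f₁ x)] at ht₁Ud
  rw [band_eq_band_posPart U f₂] at hs₂Ud
  rw [band_eq_band_posPart U (fun x => -f₂ x)] at ht₂Ud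
  -- add up: `f⁺ + f₁⁻ + f₂⁻` and `f⁻ + f₁⁺ + f₂⁺`
  have hnn : ∀ (g : (Fin 1 → ℝ) → ℝ), ∀ x ∈ U, 0 ≤ max (g x) 0 := fun g x _ => le_max_right _ _
  obtain ⟨r₁, hr₁d, hr₁i, er₁⟩ := exists_add_band hUo hfp hdfp hf1n (hnn f) (hnn fun x => -f₁ x)
    sU t₁U hsU ht₁U hsUd ht₁Ud
  have hr₁ : ∀ p ∈ r₁.domain, r₁.integrand p = 1 := fun p _ => by rw [hr₁i]
  obtain ⟨r₂, hr₂d, hr₂i, er₂⟩ := exists_add_band hUo (g := fun x => max (f x) 0 + max (-f₁ x) 0)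
    (h := fun x => max (-f₂ x) 0) (IsSemialgebraicFunOn.add_holds hfp hf1n) (hdfp.add hdf1n) hf2n
    (fun x hx => add_nonneg (hnn f x hx) (hnn (fun x => -f₁ x) x hx)) (hnn fun x => -f₂ x)
    r₁ t₂U hr₁ ht₂U hr₁d ht₂Ud
  have hr₂ : ∀ p ∈ r₂.domain, r₂.integrand p = 1 := fun p _ => by rw [hr₂i]
  obtain ⟨r₃, hr₃d, hr₃i, er₃⟩ := exists_add_band hUo hfn hdfn hf1p (hnn fun x => -f x) (hnn f₁)
    tU s₁U htU hs₁U htUd hs₁Ud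
  have hr₃ : ∀ p ∈ r₃.domain, r₃.integrand p = 1 := fun p _ => by rw [hr₃i]
  obtain ⟨r₄, hr₄d, hr₄i, er₄⟩ := exists_add_band hUo (g := fun x => max (-f x) 0 + max (f₁ x) 0)
    (h := fun x => max (f₂ x) 0) (IsSemialgebraicFunOn.add_holds hfn hf1p) (hdfn.add hdf1p) hf2p
    (fun x hx => add_nonneg (hnn (fun x => -f x) x hx) (hnn f₁ x hx)) (hnn f₂)
    r₃ s₂U hr₃ hs₂U hr₃d hs₂Ud
  have hr₄ : ∀ p ∈ r₄.domain, r₄.integrand p = 1 := fun p _ => by rw [hr₄i]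
  -- the two sums agree on `U`
  have hkey : ∀ x ∈ U, max (f x) 0 + max (-f₁ x) 0 + max (-f₂ x) 0 =
      max (-f x) 0 + max (f₁ x) 0 + max (f₂ x) 0 := by
    intro x hx
    have hx' : f x = f₁ x + f₂ x := hf (hUσ hx)
    linarith [max_zero_sub_max_neg_zero_eq_self (f x), max_zero_sub_max_neg_zero_eq_self (f₁ x),
      max_zero_sub_max_neg_zero_eq_self (f₂ x)]
  have e₂₄ : KZ.of r₂ - KZ.of r₄ ∈ planarGroup := by
    refine of_sub_of_mem_planarGroup_of_domain_eq r₂ r₄ hr₂ hr₄ ?_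
    rw [hr₂d, hr₄d]
    ext p
    simp only [mem_setOf_eq]
    constructor
    · rintro ⟨hx, h1, h2⟩
      exact ⟨hx, h1, by rw [← hkey _ hx]; exact h2⟩
    · rintro ⟨hx, h1, h2⟩
      exact ⟨hx, h1, by rw [hkey _ hx]; exact h2⟩
  -- bookkeeping
  have : (KZ.of s - KZ.of t) - (KZ.of s₁ - KZ.of t₁) - (KZ.of s₂ - KZ.of t₂) =
      ((KZ.of s - KZ.of sU) - (KZ.of t - KZ.of tU) - (KZ.of s₁ - KZ.of s₁U) + (KZ.of t₁ - KZ.of t₁U)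
        - (KZ.of s₂ - KZ.of s₂U) + (KZ.of t₂ - KZ.of t₂U))
      - (KZ.of r₂ - KZ.of r₁ - KZ.of t₂U) - (KZ.of r₁ - KZ.of sU - KZ.of t₁U)
      + (KZ.of r₄ - KZ.of r₃ - KZ.of s₂U) + (KZ.of r₃ - KZ.of tU - KZ.of s₁U)
      + (KZ.of r₂ - KZ.of r₄) := by abel
  rw [this]
  refine add_mem (add_mem (add_mem (sub_mem (sub_mem ?_ er₂) er₁) er₄) er₃) e₂₄
  exact add_mem (sub_mem (add_mem (sub_mem (sub_mem esU etU) es₁U) et₁U) es₂U) et₂U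

/-- **Rule 1a in dimension one is killed by the cell compiler**: if `σ = σ₁ ∪ σ₂` with null
overlap and the integrands agree, the cell of `τ ∘ f` over `σ` is the union of the cells of
`τ ∘ f₁`, `τ ∘ f₂` over `σ₁`, `σ₂`, overlapping inside the null cylinder over `σ₁ ∩ σ₂`: one planar
cut. (`τ = id` for the positive cells, `τ = Neg.neg` for the negative ones.)
[Kontsevich–Zagier 2001, §1.2, rule (1)] -/
theorem domainAdd_cells_mem_planarGroup (τ : ℝ → ℝ) (ρ ρ₁ ρ₂ : KZ.IntegralRep 1)
    (hdom : ρ.domain = ρ₁.domain ∪ ρ₂.domain) (h0 : volume (ρ₁.domain ∩ ρ₂.domain) = 0)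
    (h₁ : EqOn ρ.integrand ρ₁.integrand ρ₁.domain) (h₂ : EqOn ρ.integrand ρ₂.integrand ρ₂.domain)
    (s s₁ s₂ : KZ.IntegralRep 2)
    (hsd : s.domain = {p : Fin 2 → ℝ | (fun _ : Fin 1 => p 0) ∈ ρ.domain ∧ 0 < p 1 ∧
      p 1 < τ (ρ.integrand (fun _ : Fin 1 => p 0))})
    (hs₁d : s₁.domain = {p : Fin 2 → ℝ | (fun _ : Fin 1 => p 0) ∈ ρ₁.domain ∧ 0 < p 1 ∧
      p 1 < τ (ρ₁.integrand (fun _ : Fin 1 => p 0))})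
    (hs₂d : s₂.domain = {p : Fin 2 → ℝ | (fun _ : Fin 1 => p 0) ∈ ρ₂.domain ∧ 0 < p 1 ∧
      p 1 < τ (ρ₂.integrand (fun _ : Fin 1 => p 0))})
    (hs : ∀ p ∈ s.domain, s.integrand p = 1) (hs₁ : ∀ p ∈ s₁.domain, s₁.integrand p = 1)
    (hs₂ : ∀ p ∈ s₂.domain, s₂.integrand p = 1) :
    KZ.of s - KZ.of s₁ - KZ.of s₂ ∈ planarGroup := by
  refine cut_mem_planarGroup s s₁ s₂ hs hs₁ hs₂ ?_ ?_
  · rw [hsd, hs₁d, hs₂d]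
    ext p
    simp only [mem_setOf_eq, mem_union, hdom]
    constructor
    · rintro ⟨hx | hx, h1, h2⟩
      · exact Or.inl ⟨hx, h1, by rwa [← h₁ hx]⟩
      · exact Or.inr ⟨hx, h1, by rwa [← h₂ hx]⟩
    · rintro (⟨hx, h1, h2⟩ | ⟨hx, h1, h2⟩)
      · exact ⟨Or.inl hx, h1, by rwa [h₁ hx]⟩
      · exact ⟨Or.inr hx, h1, by rwa [h₂ hx]⟩
  · refine volume_eq_zero_of_base h0 ?_
    rw [hs₁d, hs₂d]
    rintro p ⟨⟨hx₁, -, -⟩, ⟨hx₂, -, -⟩⟩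
    exact ⟨hx₁, hx₂⟩

end ElementaryMoves

open ElementaryMoves in
/-- **Stub 3 (L).** `Θ` kills the elementary moves: every instance of 1a / 1b / 2 (any dimension; only dimension `1` matters, `Θ` vanishes elsewhere) is mapped into `G` (1a ↦ vertical cuts; 1b ↦ stacking shears after subdividing by the signs of `f, g, f+g`; rule 2 in dimension one ↦ the shear `(x,y) ↦ (Φ x, y/|Φ′ x|)` off the finitely many points where `Φ` is not `C²` or `Φ′ = 0`). -/
theorem stub_elementaryMoves :
    ∀ Θ : KZ.FormalRep →+ KZ.FormalRep, ((∀ ρ : KZ.IntegralRep 1, ∃ s t : KZ.IntegralRep 2, s.domain = {p : Fin 2 → ℝ | (fun _ : Fin 1 => p 0) ∈ ρ.domain ∧ 0 < p 1 ∧ p 1 < ρ.integrand (fun _ : Fin 1 => p 0)} ∧ t.domain = {p : Fin 2 → ℝ | (fun _ : Fin 1 => p 0) ∈ ρ.domain ∧ 0 < p 1 ∧ p 1 < -ρ.integrand (fun _ : Fin 1 => p 0)} ∧ (∀ p ∈ s.domain, s.integrand p = 1) ∧ (∀ p ∈ t.domain, t.integrand p = 1) ∧ Θ (KZ.of ρ)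 = KZ.of s - KZ.of t) ∧ (∀ (n : ℕ) (ρ : KZ.IntegralRep n), n ≠ 1 → Θ (KZ.of ρ) = 0)) → ∀ x ∈ KZ.domainAddRel ∪ KZ.integrandAddRel ∪ KZ.changeOfVariablesRel, Θ x ∈ AddSubgroup.closure ((KZ.domainAddRel ∪ KZ.changeOfVariablesRel) ∩ (AddSubgroup.closure {x : KZ.FormalRep | ∃ s : KZ.IntegralRep 2, (∀ p ∈ s.domain, s.integrand p = 1) ∧ x = KZ.of s} : Set KZ.FormalRep)) := by
  intro Θ hΘ x hx
  obtain ⟨hcell, hzero⟩ := hΘ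
  show Θ x ∈ planarGroup
  rcases hx with (hx | hx) | hx
  · -- rule 1a
    obtain ⟨n, r, r₁, r₂, hdom, h0, h₁, h₂, rfl⟩ := hx
    by_cases hn : n = 1
    · subst hn
      obtain ⟨s, t, hsd, htd, hs, ht, hΘr⟩ := hcell r
      obtain ⟨s₁, t₁, hs₁d, ht₁d, hs₁, ht₁, hΘr₁⟩ := hcell r₁
      obtain ⟨s₂, t₂, hs₂d, ht₂d, hs₂, ht₂, hΘr₂⟩ := hcell r₂
      rw [map_sub, map_sub, hΘr, hΘr₁, hΘr₂]
      have es := domainAdd_cells_mem_planarGroup (fun y => y) r r₁ r₂ hdom h0 h₁ h₂ s s₁ s₂ hsd hs₁d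
        hs₂d hs hs₁ hs₂
      have et := domainAdd_cells_mem_planarGroup (fun y => -y) r r₁ r₂ hdom h0 h₁ h₂ t t₁ t₂ htd ht₁d
        ht₂d ht ht₁ ht₂
      have : KZ.of s - KZ.of t - (KZ.of s₁ - KZ.of t₁) - (KZ.of s₂ - KZ.of t₂) =
          (KZ.of s - KZ.of s₁ - KZ.of s₂) - (KZ.of t - KZ.of t₁ - KZ.of t₂) := by abel
      rw [this]
      exact sub_mem es et
    · rw [map_sub, map_sub, hzero n r hn, hzero n r₁ hn, hzero n r₂ hn, sub_zero, sub_zero]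
      exact zero_mem _
  · -- rule 1b
    obtain ⟨n, r, r₁, r₂, hd₁, hd₂, hf, rfl⟩ := hx
    by_cases hn : n = 1
    · subst hn
      obtain ⟨s, t, hsd, htd, hs, ht, hΘr⟩ := hcell r
      obtain ⟨s₁, t₁, hs₁d, ht₁d, hs₁, ht₁, hΘr₁⟩ := hcell r₁
      obtain ⟨s₂, t₂, hs₂d, ht₂d, hs₂, ht₂, hΘr₂⟩ := hcell r₂
      rw [map_sub, map_sub, hΘr, hΘr₁, hΘr₂]
      exact integrandAdd_cells_mem_planarGroup r r₁ r₂ hd₁ hd₂ hf s t s₁ t₁ s₂ t₂ hsd htd hs₁d ht₁d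
        hs₂d ht₂d hs ht hs₁ ht₁ hs₂ ht₂
    · rw [map_sub, map_sub, hzero n r hn, hzero n r₁ hn, hzero n r₂ hn, sub_zero, sub_zero]
      exact zero_mem _
  · -- rule 2
    obtain ⟨n, r, r', Φ, Φ', hΦ, hΦ', hinj, hdom, hint, rfl⟩ := hx
    by_cases hn : n = 1
    · subst hn
      obtain ⟨s, t, hsd, htd, hs, ht, hΘr⟩ := hcell r
      obtain ⟨s', t', hs'd, ht'd, hs', ht', hΘr'⟩ := hcell r'
      rw [map_sub, hΘr, hΘr']
      exact changeOfVariables_cells_mem_planarGroup r r' Φ Φ' hΦ hΦ' hinj hdom hint s t s' t' hsd htd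
        hs'd ht'd hs ht hs' ht'
    · rw [map_sub, hzero n r hn, hzero n r' hn, sub_zero]
      exact zero_mem _

end Summit.KontsevichZagierPeriods.SymplecticScissors.PlanarCompilerProof
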